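import Summits.QuantumFields.YangMills.Theorems.BalabanUVNodesPortS1Selector
import Summits.QuantumFields.YangMills.Theorems.BalabanUVNodesK0PortChart44DMapsTo
import Literature.MathematicalPhysics.QuantumFieldTheory.Balaban1983to89.B12RegularSpaces111Mono

/-!
# NODE O port PT-A, [RG-I] §1 (1.11)–(1.16) pp. 262–263 — ROW S1-D: THE RECORD SPACE `recordUc` READ AGAINST PRINT's `U^c_{k+1}(X, α₀, α₁)`.
# Monotonicity in the radii, the (S1) mould ANTITONE in the radii at the record names, the record's (1.12) constant, condition (iv) DISCHARGED
# by the record's unit recipe (so (i)–(iii) ⟹ membership), the unit pair `(1, 0)` in every record space, the current of the unit field `= 0`,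
# and the two-block chart ORIGIN decoding to the unit pair — hence lying in `recordUc … X` for every `X`

Cell `ym-nodeO-ideate`, porter seat `ymgap-nodeO-port-PTA-1` (gen 2); `--supports stmt-QuantumFields-27930`; PORT-PLAN v1 row S1-D.  [I] = [Balaban1987RG1],
[15] = [Balaban1985Variational].  Print p. 263 L5–13: «Let us take the space of configurations (U, J) satisfying the conditions (i)–(iii) with constants α₀′, α₁′
instead of α₀, α₁. We assume that the constants α₀′, α₁′ are smaller than α₀, α₁ correspondingly, then obviously these three conditions are satisfied in the
original formulation. … From Proposition 9 [15] we obtain … for α₀′ sufficiently small the above estimates imply the condition (iv), thus the configuration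
(U, J) belongs to the space U^c_j(X, α₀, α₁).»

THE DICTIONARY (what this file records, in kernel terms).  `recordUc F Mc k α₀ α₁ K X` (names §3) is the `decodeCfg`-preimage of 11b's `space'` — the union of
`Gᶜ`-orbits of pairs satisfying (i)–(iv) — over the frame `Sect2.frameI (RzOfRecord F 2 K) …` whose (1.15) background functions are the record's UNIT RECIPE
(`Node00/Record12Residuals`: `RzOfRecord = Sect2.Residual.unit`, `U_n(M˙(·)) := 1`, `J_n(M˙(·)) := 0`).  Consequences proved here: (§2) the space is MONOTONE in
`(α₀, α₁)` (11b-Mono `space_mono`, the record's `O(1)LMB = 6L + 1 > 0` — PTC-1's `PortU2.recordCB_pos`, reused), so the (S1) mould `FormatPlusG` at the record names is ANTITONE in the radii — the port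
may take print's SHRUNK radii `α₀′, α₁′` in the text's `∃ α₀ α₁`; (§3) condition (iv) HOLDS FOR EVERY configuration at the record (dag-n07-e's `K0PortChart44DMapsTo.condIV_record`, reused), so a pair satisfying (i)–(iii) at `(α₀, α₁, γ₀ := α₀)` lies in the record space — the record space is print's «simple and natural space» of
p. 263 L5–8 up to orbits, and it is LARGER than print's `U^c_{k+1}(X, α₀, α₁)` with honest (iv) (located, not repaired: rows (a)(b) asked on `recordUc(α₀′, α₁′)`
are asked on print's (i)–(iii)-space, which print p. 263 L8–13 places INSIDE `U^c(α₀, α₁)` by [15] Prop. 9 — so print's (1.18)∕(1.19) on `U^c(α₀, α₁)` cover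
them; the porter's D-iv row); (§4) the unit pair `(1, 0)` lies in every record space (11b-Mono `unitPair_mem_space`), the current (1.8) of the unit field
vanishes, and the two-block chart∘embedding AT THE ORIGIN decodes to the unit pair (Selector PART 1 + `recordCurrent_zero`), hence `recordChartJ X (recordEmbJ 0)
∈ recordUc … X′` for all `X, X′` and all positive radii — the chart origin sits inside the analyticity domain of rows (a)(b).

HONEST FRAMING.  Bookkeeping on 11b ∕ 11b-Mono ∕ the names; the inclusion «(i)–(iii) at (α₀′, α₁′) ⊆ U^c(α₀, α₁) with honest (iv)» is PRINT's ([15] Prop. 9) and is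
NOT a tree theorem (the record never constructs `U_n(M˙(·))`); nothing of Bałaban's estimates asserted, ported or discharged; 27930 OPEN; K0⁷ NOT closed;
NODE O 0∕1; COUNT 8∕28 · K 1∕4 UNMOVED; finite `𝕋⁴_{L^K}` at fixed ε — NOT continuum ∕ OS ∕ Clay; **the Yang–Mills mass gap is NOT proved by any of this.**
No `sorry`, no `def`, no `instance`; standard axioms.
-/

noncomputable section

open scoped BigOperators Matrix.Norms.L2Operator Topology

namespace Summit.QuantumFields.YangMills.Theorems.BalabanUVNodesPortS1

open Summit.QuantumFields.YangMills.Theorems.K0RecordFormatNames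
open Literature.MathematicalPhysics.QuantumFieldTheory.Balaban1983to89
open Literature.MathematicalPhysics.QuantumFieldTheory.Balaban1983to89.Node00
open Literature.MathematicalPhysics.QuantumFieldTheory.Balaban1983to89.T4Continuum (T4Family)
open NormedSpace (exp)
open _root_.Filter

variable (F : T4Family)

/-! ## §1  The record's (1.12) constant `O(1)LMB = 6L + 1` and the step constants of the record frame -/

/-- The record's (1.12) constant is `6L + 1`. [cite: Balaban1987RG1, (1.12) p.262 (bookkeeping)] -/
theorem recordCB_eq : recordCB F = 6 * (F.L : ℝ) + 1 := by
  rw [recordCB, sect2NumericsOfThm1C_cB]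

/-- The step constants of the record frame: `ξ = η_K^{k+1} = L^{−(k+1)}`, `L`, `O(1)LMB = recordCB` (definitional). [cite: Balaban1987RG1, (1.11)–(1.12) p.262 (bookkeeping)] -/
theorem stepConsts_record (k K : ℕ) :
    (B12RegularSpaces111.StepConsts.ofParams (F.P K) (recordCB F) (k + 1)).ξ = (F.P K).eta (k + 1) ∧
      (B12RegularSpaces111.StepConsts.ofParams (F.P K) (recordCB F) (k + 1)).L = (F.P K).L ∧
      (B12RegularSpaces111.StepConsts.ofParams (F.P K) (recordCB F) (k + 1)).cB = recordCB F :=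
  ⟨rfl, rfl, rfl⟩

/-- `ξ = L^{−(k+1)} ≠ 0`. [cite: Balaban1987RG1, (1.1) p.260 (bookkeeping)] -/
theorem eta_record_ne_zero (K j : ℕ) : (F.P K).eta j ≠ 0 := by
  have hL : (0 : ℝ) < (F.P K).L := Nat.cast_pos.mpr (F.P K).L_pos
  exact (pow_pos (inv_pos.mpr hL) _).ne'

/-! ## §2  Monotonicity in the radii; the (S1) mould at the record names is ANTITONE in the radii -/

/-- **`recordUc` is monotone in `(α₀, α₁)`** («then obviously these three conditions are satisfied in the original formulation», p. 263; at the record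
(iv) is monotone too). [cite: Balaban1987RG1, (1.17) p.263 (the paragraph before it), (1.11)–(1.16) p.262] -/
theorem recordUc_mono (Mc k K : ℕ) (X : (recordDomSys F Mc k K).Dom) {α₀ α₀' α₁ α₁' : ℝ} (h₀ : α₀ ≤ α₀') (h₁ : α₁ ≤ α₁') :
    recordUc F Mc k α₀ α₁ K X ⊆ recordUc F Mc k α₀' α₁' K X := by
  intro u hu
  rw [mem_recordUc_iff] at hu ⊢
  obtain ⟨Ψ, hΨ, hΨu⟩ := hu
  exact ⟨Ψ, B12RegularSpaces111Mono.space_mono (PortU2.recordCB_pos F).le h₀ h₁ h₀ hΨ, hΨu⟩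

/-- **The (S1) mould at the record names (centred layer) is ANTITONE in the radii**: `FormatPlusG` with the spaces `recordUc α₀′ α₁′` implies it with
`recordUc α₀ α₁` for `α₀ ≤ α₀′`, `α₁ ≤ α₁′`, SAME pieces and constants (rows (a)(b) restrict; (1.19)'s spaces half holds at every radius,
`gaugeInv119_spaces_record`).  So in the text's `∃ α₀ α₁` the port may name print's shrunk radii. [cite: Balaban1987RG1, p.263 L5–13, (1.18)–(1.19) p.263] -/
theorem formatPlusG_record_anti (Mc k : ℕ) {α₀ α₀' α₁ α₁' : ℝ} (h₀ : α₀ ≤ α₀') (h₁ : α₁ ≤ α₁') (E₀ κ : ℝ) (K₀ : ℕ) {m : ℕ → ℕ}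
    (χ : (n : ℕ) → (recordDomSys F Mc k (K₀ + n)).Dom → (Fin (m n) → ℂ) → (Fin (recordBondCount F (K₀ + n)) → ℂ))
    {W : ℕ → Type*} [∀ n, TopologicalSpace (W n)] [∀ n, Zero (W n)] (Φf : (n : ℕ) → W n → ℂ)
    (ι : (n : ℕ) → W n → (Fin (m n) → ℂ))
    (h : B12FormatPlus.FormatPlusG (fun n => recordDomSys F Mc k (K₀ + n)) (fun n => recordBondCount F (K₀ + n))
      (fun n => recordAct F (K₀ + n)) (fun n => recordUc F Mc k α₀' α₁' (K₀ + n)) (fun n => recordCoords F Mc k (K₀ + n)) m χ Φf ι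
      (fun n => recordWrapCtr F Mc k (K₀ + n)) (fun n => recordDomEmbCtr F Mc k (K₀ + n)) (fun n _ => recordCoordProjCtr F (K₀ + n)) E₀ κ) :
    B12FormatPlus.FormatPlusG (fun n => recordDomSys F Mc k (K₀ + n)) (fun n => recordBondCount F (K₀ + n))
      (fun n => recordAct F (K₀ + n)) (fun n => recordUc F Mc k α₀ α₁ (K₀ + n)) (fun n => recordCoords F Mc k (K₀ + n)) m χ Φf ι
      (fun n => recordWrapCtr F Mc k (K₀ + n)) (fun n => recordDomEmbCtr F Mc k (K₀ + n)) (fun n _ => recordCoordProjCtr F (K₀ + n)) E₀ κ := by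
  obtain ⟨E, hA, hB, hL, hR, hV, hG⟩ := h
  exact ⟨E, fun n X u hu => hA n X u (recordUc_mono F Mc k (K₀ + n) X h₀ h₁ hu),
    fun n X u hu => hB n X u (recordUc_mono F Mc k (K₀ + n) X h₀ h₁ hu), hL, hR, hV,
    ⟨gaugeInv119_spaces_record F Mc k α₀ α₁ K₀, hG.2⟩⟩

/-! ## §3  (i)–(iii) ⟹ membership (condition (iv) at the record holds for EVERY configuration: dag-n07-e's `K0PortChart44DMapsTo.condIV_record`, reused) -/

/-- **(i)–(iii) ⟹ MEMBERSHIP IN THE RECORD SPACE** (print's «simple and natural space» of p. 263 L5–8): a units-valued pair satisfying (i)–(iii) on the record frame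
with radii `(α₀, α₁, γ₀ := α₀)`, `α₀ > 0`, lies (read through `encodeCfg ∘ embedPair`) in `recordUc … α₀ α₁ … X`. [cite: Balaban1987RG1, p.263 L5–8, (1.11)–(1.16) p.262] -/
theorem encodeCfg_embedPair_mem_recordUc_of_satisfiesI_III (Mc k K : ℕ) (X : (recordDomSys F Mc k K).Dom) {α₀ α₁ : ℝ} (h₀ : 0 < α₀)
    (Ψ : FieldPair (F.P K) 0 (MatA 2)ˣ (MatA 2))
    (hΨ : B12RegularSpaces111.SatisfiesI_III (B12RegularSpaces111SpecialUnitary.suModel 2)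
      (Sect2.frameI (RzOfRecord F 2 K) Mc (k + 1) (Sect2.domSites (F.P K) Mc (k + 1) X))
      (B12RegularSpaces111.StepConsts.ofParams (F.P K) (recordCB F) (k + 1)) α₀ α₁ α₀ Ψ) :
    encodeCfg F K (Sect2.embedPair Ψ) ∈ recordUc F Mc k α₀ α₁ K X := by
  rw [encodeCfg_mem_recordUc_iff]
  obtain ⟨hG, hg, U, A', hf, h1, h2, h3⟩ := hΨ
  exact ⟨Ψ, B12RegularSpaces111.mem_space_of_satisfies
    ⟨hG, hg, U, A', hf, h1, h2, h3, K0PortChart44DMapsTo.condIV_record F Mc k K X h₀ Ψ.U, K0PortChart44DMapsTo.condIV_record F Mc k K X h₀ U⟩, rfl⟩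

/-! ## §4  The unit pair, the current of the unit field, and the chart origin inside the record space -/

/-- **The unit pair `(1, 0)` lies in every record space** (positive radii). [cite: Balaban1987RG1, p.263 L5–13 («the minimal configurations U_j … satisfy the above conditions»), (1.11)–(1.16) p.262] -/
theorem encodeCfg_unitPair_mem_recordUc (Mc k K : ℕ) (X : (recordDomSys F Mc k K).Dom) {α₀ α₁ : ℝ} (h₀ : 0 < α₀) (h₁ : 0 < α₁) :
    encodeCfg F K (Sect2.embedPair (B12RegularSpaces111Mono.unitPair : FieldPair (F.P K) 0 (MatA 2)ˣ (MatA 2))) ∈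
      recordUc F Mc k α₀ α₁ K X := by
  rw [encodeCfg_mem_recordUc_iff]
  refine ⟨_, B12RegularSpaces111Mono.unitPair_mem_space _ (eta_record_ne_zero F K (k + 1)) ?_ (PortU2.recordCB_pos F) h₀ h₁ h₀
    (fun _ => rfl) (fun _ _ => rfl), rfl⟩
  exact Nat.cast_ne_zero.mpr (F.P K).L_pos.ne'

/-- The unit pair read in `Sect2.CPair` is `(1, 0)`. [cite: Balaban1987RG1, (1.9) p.262 (bookkeeping)] -/
theorem embedPair_unitPair (K : ℕ) :
    Sect2.embedPair (B12RegularSpaces111Mono.unitPair : FieldPair (F.P K) 0 (MatA 2)ˣ (MatA 2)) = (fun _ => 1, fun _ => 0) := rfl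

/-- **The plaquette function `ξ⁻² π Im ∂𝐔` of the UNIT field vanishes.** [cite: Balaban1987RG1, (1.8) p.261] -/
theorem imPlaq_one {P : Params} {i : ℕ} {𝔸 : Type*} [Ring 𝔸] [Algebra ℂ 𝔸] (π : 𝔸 →ₗ[ℂ] 𝔸) (ξ : ℝ) :
    B12Eq18Current.imPlaq π ξ (1 : PBond P i → 𝔸ˣ) = fun _ _ _ => 0 := by
  funext μ ν x
  simp [B12Eq18Current.imPlaq, B9Eq39Adjoint.plaqU, B12Eq18Current.dirForm]

/-- **The current (1.8) of the UNIT field vanishes**: `J(1) = D^{ξ*} ξ⁻² π Im ∂1 = 0`. [cite: Balaban1987RG1, (1.8) p.261] -/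
theorem current_one {P : Params} {i : ℕ} {𝔸 : Type*} [Ring 𝔸] [Algebra ℂ 𝔸] (π : 𝔸 →ₗ[ℂ] 𝔸) (ξ : ℝ) :
    B12Eq18Current.current π ξ (1 : PBond P i → 𝔸ˣ) = 0 := by
  funext b
  rw [B12Eq18Current.current_apply, imPlaq_one]
  simp [B9Eq39Adjoint.divP, B9Eq39Adjoint.covDstar, B9Eq39Adjoint.R]

/-- **`J_{k+1}(W_0) = 0`**: the record current of the charted configuration at `B = 0` vanishes (`U_{k+1}(W_0) = 1` in the rooted gauge, Selector PART 1,
and `current_one`); standing range `k + 1 ≤ m + K`. [cite: Balaban1987RG1, (1.8) p.261, (2.3) p.265] -/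
theorem recordCurrent_zero (θ : Stage13Params F 2) {k K : ℕ} (hk : k + 1 ≤ (F.P K).m + (F.P K).K) :
    letI := θ.instVβ₁; letI := θ.instVβ₂
    recordCurrent F θ k K (0 : Fin (F.P K).d → Site (F.P K) (k + 1) → θ.Vβ) = 0 := by
  letI := θ.instVβ₁; letI := θ.instVβ₂
  funext b
  rw [recordCurrent, recordBgUnits_zero F θ hk]
  exact congrFun (current_one (P := F.P K) (i := 0) sl2Proj ((F.P K).eta (k + 1))) b

open scoped Classical in
/-- **THE CHART ORIGIN DECODES TO THE UNIT PAIR**: `decodeCfg (recordChartJ X (recordEmbJ 0)) = (1, 0)` (`U_{k+1}(W_0) = 1` on and off `X`, `J(1) = 0`).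
[cite: Balaban1987RG1, (1.9) p.261, (2.3) p.265] -/
theorem decodeCfg_recordChartJ_recordEmbJ_zero_eq_unitPair (θ : Stage13Params F 2) (Mc : ℕ) {k K : ℕ} (hk : k + 1 ≤ (F.P K).m + (F.P K).K)
    (X : (recordDomSys F Mc k K).Dom) :
    letI := θ.instVβ₁; letI := θ.instVβ₂
    decodeCfg F K (recordChartJ F Mc k K X (recordEmbJ F θ k K 0)) = (fun _ => 1, fun _ => 0) := by
  letI := θ.instVβ₁; letI := θ.instVβ₂
  rw [decodeCfg_recordChartJ_recordEmbJ_zero F θ Mc hk X, recordBgField_zero F θ hk, recordCurrent_zero F θ hk]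
  refine Prod.ext (funext fun b => ?_) (funext fun b => ?_)
  · show (if b ∈ domBonds F Mc k K X then (((1 : GaugeField (F.P K) 0 (SU 2)) b : SU 2) : MatA 2) else 1) = 1
    split_ifs
    · show (((1 : SU 2)) : MatA 2) = 1
      simp
    · rfl
  · show (if b ∈ domBonds F Mc k K X then (0 : PBond (F.P K) 0 → MatA 2) b else 0) = 0
    split_ifs <;> rfl

open scoped Classical in
/-- **THE CHART ORIGIN LIES IN EVERY RECORD SPACE**: `recordChartJ X (recordEmbJ 0) ∈ recordUc … α₀ α₁ … X′` for all `X, X′`, positive radii, `k + 1 ≤ m + K` —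
the analyticity domain of rows (a)(b) contains the point at which row (f) is read. [cite: Balaban1987RG1, p.263 L5–13, (1.9) p.261] -/
theorem recordChartJ_recordEmbJ_zero_mem_recordUc (θ : Stage13Params F 2) (Mc : ℕ) {k K : ℕ} (hk : k + 1 ≤ (F.P K).m + (F.P K).K)
    (X X' : (recordDomSys F Mc k K).Dom) {α₀ α₁ : ℝ} (h₀ : 0 < α₀) (h₁ : 0 < α₁) :
    letI := θ.instVβ₁; letI := θ.instVβ₂
    recordChartJ F Mc k K X (recordEmbJ F θ k K 0) ∈ recordUc F Mc k α₀ α₁ K X' := by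
  letI := θ.instVβ₁; letI := θ.instVβ₂
  have h := encodeCfg_unitPair_mem_recordUc F Mc k K X' h₀ h₁
  rw [embedPair_unitPair, ← decodeCfg_recordChartJ_recordEmbJ_zero_eq_unitPair F θ Mc hk X, encodeCfg_decodeCfg] at h
  exact h

end Summit.QuantumFields.YangMills.Theorems.BalabanUVNodesPortS1

end
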